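import Summits.HodgeConjecture.HodgeCM.Model.AdelicThetaDistributionFin_1
import Summits.HodgeConjecture.HodgeCM.Model.ArchSideOfTwist
import Literature.NumberTheory.Automorphic.UnitaryGroupArchLatticeJunction
import HarnessLib

/-!
# FLOOR-0 P4, seat S4′(i), junction (J-d∕e) — THE KNOB: extending a finite-adelic character to `U(V)(𝔸)` trivially at ∞, and how the side's
# `U(V)`-twist `ν` moves the scalar `finCharZero` of the model's finite Weil representation

Cell hodgecm-mathlib (D-0151), FLOOR 0, crux item H413 = stmt-HodgeConjecture-24833; programme P4, line
`Cruxes/H413/Lines/F0_P4AdmissibleOccursInH1.lean`, stub S4′.  Author F0P4-p01 (g0) (seat (i)); SEAT-i MEMO v2 §5 (J-d).  `--supports stmt-HodgeConjecture-24833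
--as helper`.  DEF-FREE (`∃`-statements and identities).

★ `Theorems/H413HolRealOfTransport.exists_holReal_of_transport` needs the `U(V)(𝔸_f)`-scalar of the model's `D.ωf (g,1)` along `finSBReindex e₁` —
`finCharZero … η₀ (g,1)` (★ `Theorems/H413FinRepZeroTransportLaws`) — to EQUAL the character `λ` of the line transport (LT, A-p17 (g12)).  The side
★ `ThetaDistAtLine.sideAt … η … ν …` has `η₀ = etaT₀ η ν = (ν⁻¹ ∘ fst) · eta₀ η` (★ `ArchSideOfTwist.etaT₀`), so the knob is `ν`:

* §1 **`finCharZero_etaT₀`** — `finCharZero … (etaT₀ η ν) (g,u) = (ν (finAdelicToAdelic (finFrameCongr g)))⁻¹ · finCharZero … (eta₀ η) (g,u)`: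
  the twist divides the scalar by `ν` read on the frame-congruent finite point; hence **`finCharZero_etaT₀_eq_iff`**: `finCharZero … (etaT₀ η ν) (g,1) = λ g`
  iff `ν (finAdelicToAdelic (finFrameCongr g)) = finCharZero … (eta₀ η) (g,1) · (λ g)⁻¹` — THE KNOB EQUATION.
* §2 **`exists_character_extend_finPart`** — ANY continuous character `κ` of `U(J)(𝔸_f)` trivial on the rational points `U(J)(F)` (through
  `rationalToFinAdelic`) EXTENDS to a continuous character `ν := κ ∘ finPart` of `U(J)(𝔸)` trivial on `U(J)(F)` (through `toAdelic`) and at the archimedean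
  component, with `ν ∘ finAdelicToAdelic = κ` (★ `UnitaryGroup.finPart_finAdelicToAdelic`, `finPart_toAdelic`, `finPart_archToAdelic`, `continuous_finPart`)
  — the shape `(ν, hν, hνc)` that `sideAt`∕`archSideOfT` consume; applied at `J = diagonal (frameD V)` it solves the knob equation as soon as the right-hand
  side is continuous (★ `continuous_cmLineChar₀_of_signs`, `hηc`, LT's continuity) and rational-trivial (★ `cmLineChar₀_inl_eq_one_of_rat`, `hη`, and (G4) for `λ`).

HC_CM is proved only modulo the printed citations until rung 0 closes.

## References
* [BorelJacquet1979] A. Borel, H. Jacquet, Corvallis PSPM 33.1, §4.1 (`G(𝔸) = G_∞ × G(𝔸_f)`).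
* [GelbartRogawski1991] S. Gelbart, J. Rogawski, Invent. Math. 105 (1991), §3.1 Remark p. 457 L4–13 (twists of splittings by automorphic characters).
* Tree: ★ `Literature/NumberTheory/Automorphic/UnitaryGroupAdelicProduct` (`finPart`, `finPart_finAdelicToAdelic`, `finPart_archToAdelic`, `continuous_finPart`),
  ★ `…/UnitaryGroupArchLatticeJunction` (`finPart_toAdelic`), ★ `HodgeCM/Model/AdelicThetaDistributionFin_1` (`finCharZero_apply`), ★ `HodgeCM/Model/ArchSideOfTwist` (`etaT₀`).
-/

set_option autoImplicit false
set_option linter.dupNamespace false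

noncomputable section

open NumberField NumberField.mixedEmbedding IsDedekindDomain
open scoped Matrix TensorProduct Classical SchwartzMap
open Literature.NumberTheory.Automorphic Literature.NumberTheory.Weil1964
open Literature.NumberTheory.GelbartRogawski1991 Literature.NumberTheory.GelbartRogawski1991.UnitaryDualPair
open HodgeCM HodgeCM.Adelic HodgeCM.PerL34 HodgeCM.Model HodgeCM.Model.ArchSideTerm HodgeCM.Model.ThetaDistFin

namespace Summit.HodgeConjecture.HodgeConjecture.Cruxes.H413.ThetaJunction

/-! ## §1 The twist `ν` divides the scalar `finCharZero` -/

section Twist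

variable {L : CMField} {ι₁ : L →+* ℂ} (V : HermSpace3 L ι₁) (S : StubTree.SeesawDatum L)
  (hGR : (cmSplittingDatum (L : Type) finProdFinEquiv (frameD V) (frameD_real V) (frameD_ne V) (dW S) (dW_real S)
    (dW_ne S)).CompatibleSplitting)
  (hGR₀ : (cmSplittingDatum (L : Type) (e₁) (frameD V) (frameD_real V) (frameD_ne V) (lineVec (L : Type) (dW S 0))
    (fun _ => dW_real S 0) (fun _ => dW_ne S 0)).CompatibleSplitting)
  (hGR₁ : (cmSplittingDatum (L : Type) (e₁) (frameD V) (frameD_real V) (frameD_ne V) (lineVec (L : Type) (dW S 1))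
    (fun _ => dW_real S 1) (fun _ => dW_ne S 1)).CompatibleSplitting)
  (η : CMAdelic (L : Type) (frameD V) × CMAdelic (L : Type) (dW S) →* ℂˣ) (ν : CMAdelic (L : Type) (frameD V) →* ℂˣ)

/-- **the twist divides the scalar**: `finCharZero (etaT₀ η ν) (g,u) = (ν (finAdelicToAdelic (finFrameCongr g)))⁻¹ · finCharZero (eta₀ η) (g,u)`.
[cite: GelbartRogawski1991, §3.1 Remark p. 457 L4–13] -/
theorem finCharZero_etaT₀ (g : ↥V.adelicFin) (u : UfZero S) :
    finCharZero V S hGR hGR₀ hGR₁ (etaT₀ V S η ν) (g, u) =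
      (ν (UnitaryGroup.finAdelicToAdelic (↥(maximalRealSubfield L)) (L : Type) (IsCMField.complexConj L) 3 (Matrix.diagonal (frameD V))
          (finFrameCongr (L : Type) V.Hm (frameG V) (frameD V) (frame_congr V) g)))⁻¹ *
        finCharZero V S hGR hGR₀ hGR₁ (eta₀ V S η) (g, u) := by
  rw [finCharZero_apply, finCharZero_apply, etaT₀_apply, mul_assoc]

/-- **THE KNOB EQUATION**: for a target scalar `lam g`, `finCharZero (etaT₀ η ν) (g,u) = lam` iff `ν` at the frame-congruent finite point equals
`finCharZero (eta₀ η) (g,u) · lam⁻¹`. [cite: GelbartRogawski1991, §3.1 Remark p. 457 L4–13] -/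
theorem finCharZero_etaT₀_eq_iff (g : ↥V.adelicFin) (u : UfZero S) (lam : ℂˣ) :
    finCharZero V S hGR hGR₀ hGR₁ (etaT₀ V S η ν) (g, u) = lam ↔
      ν (UnitaryGroup.finAdelicToAdelic (↥(maximalRealSubfield L)) (L : Type) (IsCMField.complexConj L) 3 (Matrix.diagonal (frameD V))
          (finFrameCongr (L : Type) V.Hm (frameG V) (frameD V) (frame_congr V) g)) =
        finCharZero V S hGR hGR₀ hGR₁ (eta₀ V S η) (g, u) * lam⁻¹ := by
  rw [finCharZero_etaT₀]
  constructor
  · intro h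
    rw [← h, mul_inv_rev, inv_inv, mul_inv_cancel_left]
  · intro h
    rw [h, mul_inv_rev, inv_inv, inv_mul_cancel_right]

end Twist

/-! ## §2 Extending a finite-adelic automorphic character to `U(J)(𝔸)`, trivially at ∞ -/

section Extend

variable (F E : Type) [Field F] [NumberField F] [Field E] [NumberField E] [Algebra F E] (c : E ≃ₐ[F] E) (N : ℕ)
  (J : Matrix (Fin N) (Fin N) E)

/-- **extension by the finite part**: a continuous character `κ` of `U(J)(𝔸_f)` trivial on `U(J)(F)` extends to a continuous character `ν` of `U(J)(𝔸)`
with `ν ∘ finAdelicToAdelic = κ`, `ν ∘ archToAdelic = 1`, and `ν` trivial on the rational points `toAdelic (U(J)(F))` — the shape `(ν, hν, hνc)` of ★ `archSideOfT`.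
[cite: BorelJacquet1979, §4.1] [cite: GelbartRogawski1991, §3.1 Remark p. 457 L4–13] -/
theorem exists_character_extend_finPart (κ : UnitaryGroup.finAdelic F E c N J →* ℂˣ) (hκc : Continuous fun b => ((κ b : ℂˣ) : ℂ))
    (hκ : ∀ γ : UnitaryGroup.rational F E c N J, κ (UnitaryGroup.rationalToFinAdelic F E c N J γ) = 1) :
    ∃ ν : (UnitaryGroup.adelicGroupData F E c N J).Adelic →* ℂˣ,
      (∀ g ∈ (UnitaryGroup.toAdelic F E c N J).range, ν g = 1) ∧ (Continuous fun v => ((ν v : ℂˣ) : ℂ)) ∧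
        (∀ b : UnitaryGroup.finAdelic F E c N J, ν (UnitaryGroup.finAdelicToAdelic F E c N J b) = κ b) ∧
          ∀ a : UnitaryGroup.arch F E c N J, ν (UnitaryGroup.archToAdelic F E c N J a) = 1 := by
  refine ⟨κ.comp (UnitaryGroup.finPart F E c N J), ?_, ?_, fun b => ?_, fun a => ?_⟩
  · rintro _ ⟨γ, rfl⟩
    rw [MonoidHom.comp_apply, UnitaryGroup.finPart_toAdelic, hκ]
  · exact hκc.comp (UnitaryGroup.continuous_finPart F E c N J)
  · rw [MonoidHom.comp_apply, UnitaryGroup.finPart_finAdelicToAdelic]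
  · rw [MonoidHom.comp_apply, UnitaryGroup.finPart_archToAdelic, map_one]

end Extend

end Summit.HodgeConjecture.HodgeConjecture.Cruxes.H413.ThetaJunction

end
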